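import Literature.Barriers.ABC.NoArithmeticDerivative
import HarnessLib

/-!
# Pasten 2021, Theorem 2.6: a Siegel basis of the lattice `𝒯(a,b)` of adapted arithmetic derivations
# with `∏ ‖ψᵢ‖ ≤ ω(abc)/(2 log 2) · c log c` — ONE named fact (sibling of `NoArithmeticDerivative.lean`)

H. Pasten, *Arithmetic derivatives through geometry of numbers*, Canad. Math. Bull. 65 (2022)
906–923 (= arXiv:2106.16165), Theorem 2.6 (p. 5 of the arXiv version), verbatim:

"**Theorem 2.6** (Existence of arithmetic derivatives of controlled size). Suppose that `a, b` are
coprime positive integers with `c := a + b > 2`, i.e., `(a,b) ≠ (1,1)`. Then `𝒯(a,b)` has rank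
`r := ω(abc) − 1 ≥ 1` and there are `ℤ`-linearly independent derivations `ψ₁, …, ψ_r ∈ 𝒯(a,b)`
satisfying `∏_{i=1}^r ‖ψᵢ‖ ≤ ω(abc)/(2 log 2) · c log c`."

Here `𝒯(a,b) = {ψ : supp ψ ⊆ supp(ab(a+b)), d^ψ(a+b) = d^ψ a + d^ψ b}` (§2.2; the tree's
`Pasten.IsAdapted ψ a b`, derivations encoded by their values `ψ(ξ_p)` at primes), `‖ψ‖ = sup_p |ψ(ξ_p)|`
(§2.1), `ω(n) = #supp(n)`. The proof is Siegel's lemma in the Bombieri–Vaaler form (Theorem 2.5 of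
the source = [BombieriVaaler1983] Theorem 2, resting on Minkowski's second theorem) applied to the one
homogeneous equation (EqnAdd) whose coefficients are positive integers `≤ c log₂(c)/2`. Minkowski's
second theorem / the Bombieri–Vaaler lemma are not in Mathlib or the tree, so the theorem is typed as
ONE named fact `Pasten.SiegelBasis` (+1 declared debt), in the Lean text requested by the
`route-ABC-RootDecompF` lens seats (`decomp-abc-lens-5`; audited faithful against the materialised
p. 5 by `decomp-abc-crit-1`): `r = n + 1` with `n + 2 = ω(abc)`; the family `ψs : Fin (n+1) → (ℕ → ℤ)`
`ℤ`-linearly independent in `ℕ → ℤ`, each `ψs i ∈ 𝒯(a,b)`; the norms through dominating constants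
`B i ≥ |ψs i (p)|` with `∏ B i ≤ ω(abc)/(2 log 2)·c·log c` (equivalent to the printed `∏‖ψᵢ‖ ≤ …`:
take `B i = ‖ψᵢ‖`, conversely `‖ψᵢ‖ ≤ B i`). The tree already holds, PROVED, the one-derivation
consequence Lemma 3.5 (`Pasten.exists_adapted_independent_holds`, by the explicit two-prime
derivation of Example 3.6 — no geometry of numbers); what Theorem 2.6 adds is the FULL basis with the
product bound, i.e. a derivation of norm `≤ (ω(abc) c log c/(2 log 2))^{1/r}` (Corollary 2.7, whose
finite form `SiegelBasis.exists_pow_le` is PROVED here from the fact).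

## References

* [Pasten2021] H. Pasten, Canad. Math. Bull. 65 (2022) 906–923 = arXiv:2106.16165: §2.1–2.2
  (`𝒯`, `‖·‖`, `𝒯(a,b)`, Lemma 2.4), Thm. 2.5 (Siegel's lemma), Thm. 2.6, Cor. 2.7 (p. 5).
* [BombieriVaaler1983] E. Bombieri, J. Vaaler, *On Siegel's lemma*, Invent. Math. 73 (1983) 11–32,
  Theorem 2.
-/

noncomputable section

namespace Literature.Barriers.ABC.Pasten

open Literature.NumberTheory.DiophantineGeometry

/-- **Pasten 2021, Theorem 2.6 (Siegel basis of `𝒯(a,b)`; named fact).** For every abc triple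
`(a, b, c)` (`a, b` coprime positive, `a + b = c`) with `(a, b) ≠ (1, 1)`: `ω(abc) = n + 2 ≥ 2` and
there are `n + 1 = ω(abc) − 1` `ℤ`-linearly independent adapted derivations `ψ₀, …, ψ_n ∈ 𝒯(a,b)`
(`Pasten.IsAdapted`) with norm bounds `|ψᵢ(ξ_p)| ≤ Bᵢ` for all `p` and
`∏ᵢ Bᵢ ≤ ω(abc)/(2 log 2) · c · log c`. +1 declared debt: Siegel's lemma in the Bombieri–Vaaler form
(Thm. 2.5; Minkowski's second theorem) is not in the tree. [cite: Pasten2021, Theorem 2.6 (arXiv:2106.16165 p. 5)]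
[cite: BombieriVaaler1983, Theorem 2] -/
def SiegelBasis : Prop :=
  ∀ a b c : ℕ, IsABCTriple a b c → (a, b) ≠ (1, 1) →
    ∃ n : ℕ, n + 2 = (a * b * c).primeFactors.card ∧
      ∃ ψs : Fin (n + 1) → (ℕ → ℤ), LinearIndependent ℤ ψs ∧ (∀ i, IsAdapted (ψs i) a b) ∧
        ∃ B : Fin (n + 1) → ℝ, (∀ i, ∀ p : ℕ, (|ψs i p| : ℝ) ≤ B i) ∧
          ∏ i, B i ≤ ((a * b * c).primeFactors.card : ℝ) / (2 * Real.log 2) * (c : ℝ) * Real.log c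

/-- **Corollary 2.7 in finite form** ("choosing the smallest derivation provided by the previous
theorem"): from the fact, every abc triple with `(a,b) ≠ (1,1)` carries a nonzero adapted derivation
`ψ ∈ 𝒯(a,b)` (a member of a `ℤ`-linearly independent family) with
`‖ψ‖^{r} ≤ ω(abc)/(2 log 2) · c log c`, `r = ω(abc) − 1` — since `∏ᵢ Bᵢ ≥ (minᵢ Bᵢ)^r`.
[cite: Pasten2021, Corollary 2.7 (proof)] -/
theorem SiegelBasis.exists_pow_le (h : SiegelBasis) {a b c : ℕ} (habc : IsABCTriple a b c)
    (hab : (a, b) ≠ (1, 1)) :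
    ∃ n : ℕ, n + 2 = (a * b * c).primeFactors.card ∧
      ∃ ψ : ℕ → ℤ, ψ ≠ 0 ∧ IsAdapted ψ a b ∧ ∃ B : ℝ, (∀ p : ℕ, (|ψ p| : ℝ) ≤ B) ∧
        B ^ (n + 1) ≤ ((a * b * c).primeFactors.card : ℝ) / (2 * Real.log 2) * (c : ℝ) * Real.log c := by
  obtain ⟨n, hn, ψs, hli, had, B, hB, hprod⟩ := h a b c habc hab
  refine ⟨n, hn, ?_⟩
  -- the index of the smallest bound
  obtain ⟨i₀, -, hi₀⟩ := Finset.exists_min_image Finset.univ B Finset.univ_nonempty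
  have hB0 : ∀ i, 0 ≤ B i := fun i => (abs_nonneg _).trans (hB i 2)
  refine ⟨ψs i₀, hli.ne_zero i₀, had i₀, B i₀, hB i₀, ?_⟩
  calc B i₀ ^ (n + 1) = ∏ _i : Fin (n + 1), B i₀ := by simp
    _ ≤ ∏ i, B i := Finset.prod_le_prod (fun i _ => hB0 i₀) fun i hi => hi₀ i hi
    _ ≤ _ := hprod

end Literature.Barriers.ABC.Pasten

end
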